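import Mathlib
import HarnessLib
import Summits.HubbardSuperconductivity.HubbardSuperconductivity.Theorems.KLProgrammeKLRegimeEngineTwoLegStepV17F2ClosersRaise
import Summits.HubbardSuperconductivity.HubbardSuperconductivity.Theorems.KLProgrammeKLRegimeEngineTwoLegSlopesBareFrame
import Summits.HubbardSuperconductivity.HubbardSuperconductivity.Theorems.KLProgrammeKLRegimeEngineV8DefsU9

/-!
# Route `KLProgramme` — ENGINE child gen 8 (stmt-HubbardSuperconductivity-20437 `KLRegimeEngineV17F2`), skeleton v2, CLASS #7 IN GRID CURRENCY:
# the two-leg moments atom `TwoLegGridMomentsAt` (the two pinned grid sums of `kernel₂ (W_n[K] − 𝒩_{K,4M})`), its consumers into stub (e), and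
# the n = 0 BASE, PROVED (cell gate-hubbard-kl, seat hubbard-kl-r2d-p1 g8 = class-#7 text owner; input for the 08-29 #7 word)

WHY A SECOND KEYING.  The class-#7 text of record (`…EngineV8TwoLegMomentsExport`, p548102) keys the (b) → (e) two-leg moments to the trivial-multiplier
position kernel of `𝒱⁽ⁿ⁾[K_n] − 𝒩_{K_n}` on the DUAL `2M`-point time lattice (keying (i)).  k3c2-p1 (KL STATUS 2026-08-27T18:28Z, (4)) computed that the
dual kernel is the `4M`-grid kernel convolved with the `2M`-frequency Dirichlet kernel (odd grid offsets, `ε`-weighted ℓ¹ mass `(2/π)·log M + 1.40`, first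
circular-time moment `0.3712·β`, `M`-independent), so no `β`-uniform norm pushforward grid → dual exists and the dual n = 0 base costs new symbol-smoothness /
wrap-around estimates.  The obstruction is NOT special to `n = 0`: `𝒱⁽ⁿ⁾[K_n] = effAction (C^{K_n}_{>Λ_n}) V_{K_n}` is CUMULATIVE (`C_{>Λ_n} ⊇ C_{>Λ_0}`), its
two-leg kernel contains the ultraviolet-integrated part at every scale, and a smooth-multiplier (sectorised) tower never produces the trivial-multiplier
dual moments.  The `4M`-GRID currency has none of this: the grid vertex is ultralocal (`map_hubbardGridSub_gridInteraction`), the representation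
`𝒱⁽ⁿ⁾[K] − 𝒩_K = map S_{4M} (W_n[K] − 𝒩_{K,4M})` holds at EVERY scale and frame (`…SplitTwoLegGridScale`, p536884), BOTH rows of stub (e) — B1′
`|z_n(K_n) − 1|` and B2′ the shell-tube gradient of `I_L[Re Σ_n(K_n) − K_n∘p]` — are read off two pinned grid sums (`…ClosersGrid` p538113 /
`stub_twoLeg_step_of_gridMoments_GQJ` p546067), and the n = 0 grid moments are PROVED (`twoLeg_time_sum_frameZero_le` /
`twoLeg_offDiag_moment_pow_sum_frameZero_le`, p526252, with p3's weighted covariance constant `A₁(R,U) ≤ klE3A1 R`).  It is also the native output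
of a position-space one-shot expansion (BGM's `W^{(h)}_2(x)`, (2.17), in continuous time = the grid as `M → ∞`).  This file is the class-#7 text in that
currency — a CANDIDATE beside p548102, for the E1 lead's 08-29 word ((Y) keyed GRID):

* §1 **`TwoLegGridMomentsAt L M Zt Zs β U μ K n`** (frame-generic atom) := with `N = 4M`, `W' := effAction (S_Nᵀ C^K_{>Λ_n} S_N) (V_N + 𝒩_{K,N}) − 𝒩_{K,N}`:
  for both spins and every grid pin `p₀`, `Σ_{p₁} (β/N)·circDist_N(j₀,j₁)·‖kernel₂ W' ((p₀,σ,+),(p₁,σ,−))‖ ≤ Zt·U²·β/(2N)` AND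
  `Σ_{p₁} [x⃗₁ ≠ x⃗₀](1+|Δx̃₀|+|Δx̃₁|)·‖kernel₂ W' (…)‖ ≤ Zs·U²·β/(2N)` — VERBATIM the `hBt`/`hB1` rows of `stub_twoLeg_step_of_gridMoments_GQJ` with
  the conversions `(2N/β)·B = Z·U²` built in; **`TwoLegGridFlowMomentsAt L M Zt Zs β U μ n`** := the atom at the flow frame `K_n` (THE EXPORT); `.mono`,
  `_iff`, `.budget_nonneg`;
* §2 CONSUMERS (ns `EngineV8`): `twoLeg_slopeSizes_of_twoLegGridMomentsAt` (any `K`, `n`: `|klFieldStrength … K n k − 1| ≤ Zt·U²` at every torus momentum,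
  `‖fderiv (evalM (symInterp L (klLocSelfEnergyRe … K n − K∘p))) q‖ ≤ Zs·U²` at every `q`); **`stub_twoLeg_step_of_twoLegGridMomentsAt_GQJ`** (stub (e)'s
  literal binders at `(G, Q, cJ, cJ')` + `hD : TwoLegGridFlowMomentsAt …` + allowance rows `Zt ≤ 2^10·e¹⁸κ₀⁴·klE3Acum R`, `Zs ≤ 2^11·…` + C1/C2 ⇒
  `TwoLegStepV17F2 …`); **`…_thr_GQJ`** (allowances and the `klE3U₀all` door replaced by ONE door `U₀c ≤ klTwoLegMomU R Zt Zs`); and the v2-day one-liners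
  **`stub_twoLeg_step_of_twoLegGridMomentsAt_raise` / `…_thr_raise`** (geometry `klEngGeo8`, any raise `Q` of `klEngQ7 P R`, doors `klEngU₀10`/`klEngL₄`);
* §3 **THE n = 0 BASE, PROVED**: `twoLegGridMomentsAt_frameZero_of_bareAlpha` (any `a₁ ≥ A₁(R,U)` with `16e⁹κ₀²a₁|U| ≤ 1/2` ⇒ the atom at `(K, n) = (0, 0)`
  with `(Zt, Zs) = (2^10, 2^11)·e¹⁸κ₀⁴·a₁`), **`twoLegGridFlowMomentsAt_zero_klE3A1`** (under the registered door `U ≤ klEngU₀9 P R c`: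
  `TwoLegGridFlowMomentsAt L M (2^10·e¹⁸κ₀⁴·klE3A1 R) (2^11·e¹⁸κ₀⁴·klE3A1 R) β U μ 0`; the v2 door `klEngU₀10 ≤ klEngU₀9` is one `le_trans`) and
  `twoLegGridMoments_zero_allowance` (these constants sit inside the (e) allowance rows, `klE3A1 ≤ klE3Acum`).

Definitions with bodies + proofs; no step Prop / deferred package here (their shape is the pen's (R57d), typed after the 08-29 word with the atom of
the chosen keying); nothing about the model is asserted; nothing asserts superconductivity.
References: BGM 2006 §2.1 (2.4)–(2.5), §2.3 (2.17), §2.4 (2.36), §3 (3.2)–(3.3) [cite: BenfattoGiulianiMastropietro2006].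
-/

noncomputable section

namespace Summit.HubbardSuperconductivity.HubbardSuperconductivity.Theorems.KLRegimeSplit

set_option linter.dupNamespace false -- summit = problem name (single-conjunct summit), D-0017

open Finset Complex
open Literature.MathematicalPhysics.QuantumLattice Literature.Probability.LatticeModels GrassmannAlgebra
open Summit.HubbardSuperconductivity.HubbardSuperconductivity.Theorems.KLProgrammeLegKernels

/-! ## §1 The two-leg GRID moments atom and the class-#7 export in grid currency -/

section Model

variable (L M : ℕ) [NeZero L]

/-- **`TwoLegGridMomentsAt L M Zt Zs β U μ K n`** — at frame `K`, scale `n`, on the `N = 4M` time grid, with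
`W' := effAction (S_Nᵀ C^K_{>Λ_n} S_N) (V_N + 𝒩_{K,N}) − 𝒩_{K,N}` (`Λ_n = klScale klE0 n`; `map S_N W' = 𝒱⁽ⁿ⁾[K] − 𝒩_K` by
`klEffectiveAction_sub_counterQuadratic_eq_map_gridSub_scale`): for both spins `σ` and every grid pin `p₀`,
(time) `Σ_{p₁} (β/N)·circDist_N(j₀, j₁)·‖kernel₂ W' ((p₀,σ,+),(p₁,σ,−))‖ ≤ Zt·U²·β/(2N)` and
(space) `Σ_{p₁} [x⃗₁ ≠ x⃗₀]·(1+|Δx̃₀|+|Δx̃₁|)·‖kernel₂ W' ((p₀,σ,+),(p₁,σ,−))‖ ≤ Zs·U²·β/(2N)` — VERBATIM the `hBt`/`hB1` rows of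
`EngineV8.stub_twoLeg_step_of_gridMoments_GQJ`, normalised so that its conversions read `(2N/β)·Bt = Zt·U²`, `(2N/β)·B₁ = Zs·U²`. -/
def TwoLegGridMomentsAt (Zt Zs : ℝ) (β U μ : ℝ) (K : TrigPolyC4v) (n : ℕ) : Prop :=
  (∀ (σ : Fin 2) (p₀ : GridPoint L (2 * (2 * M))), ∑ p₁ : GridPoint L (2 * (2 * M)),
      β / ((2 * (2 * M) : ℕ) : ℝ) * (circDist (2 * (2 * M)) p₀.1.val p₁.1.val : ℝ) *
        ‖kernel ℂ
          (effAction ℂ ((hubbardGridSub L M β (2 * (2 * M))).transpose *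
              hubbardCovAboveCT L M β μ 0 K (klScale klE0 n) * hubbardGridSub L M β (2 * (2 * M)))
            (hubbardGridInteraction L (2 * (2 * M)) β U + hubbardGridCounterQuadratic L (2 * (2 * M)) β K) -
            hubbardGridCounterQuadratic L (2 * (2 * M)) β K) 2
          (fun i => ((![p₀, p₁] i, σ), i))‖ ≤ Zt * U ^ 2 * (β / (2 * ((2 * (2 * M) : ℕ) : ℝ)))) ∧
  (∀ (σ : Fin 2) (p₀ : GridPoint L (2 * (2 * M))), ∑ p₁ : GridPoint L (2 * (2 * M)),
      (if p₁.2 - p₀.2 = 0 then (0 : ℝ) else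
        (1 + (((p₁.2 - p₀.2) 0).valMinAbs.natAbs : ℝ) + (((p₁.2 - p₀.2) 1).valMinAbs.natAbs : ℝ)) ^ 1) *
        ‖kernel ℂ
          (effAction ℂ ((hubbardGridSub L M β (2 * (2 * M))).transpose *
              hubbardCovAboveCT L M β μ 0 K (klScale klE0 n) * hubbardGridSub L M β (2 * (2 * M)))
            (hubbardGridInteraction L (2 * (2 * M)) β U + hubbardGridCounterQuadratic L (2 * (2 * M)) β K) -
            hubbardGridCounterQuadratic L (2 * (2 * M)) β K) 2
          (fun i => ((![p₀, p₁] i, σ), i))‖ ≤ Zs * U ^ 2 * (β / (2 * ((2 * (2 * M) : ℕ) : ℝ))))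

variable {L M}

/-- Budget monotonicity of the grid atom (`0 ≤ β`). -/
theorem TwoLegGridMomentsAt.mono {Zt Zs Zt' Zs' β U μ : ℝ} {K : TrigPolyC4v} {n : ℕ} (h : TwoLegGridMomentsAt L M Zt Zs β U μ K n)
    (hβ : 0 ≤ β) (ht : Zt ≤ Zt') (hs : Zs ≤ Zs') : TwoLegGridMomentsAt L M Zt' Zs' β U μ K n := by
  have hw : 0 ≤ β / (2 * ((2 * (2 * M) : ℕ) : ℝ)) := by positivity
  exact ⟨fun σ p₀ => (h.1 σ p₀).trans (mul_le_mul_of_nonneg_right (mul_le_mul_of_nonneg_right ht (sq_nonneg U)) hw),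
    fun σ p₀ => (h.2 σ p₀).trans (mul_le_mul_of_nonneg_right (mul_le_mul_of_nonneg_right hs (sq_nonneg U)) hw)⟩

/-- The two budgets of the grid atom are nonnegative as soon as `U ≠ 0`, `0 < β` and `M ≠ 0` (the grid sums are nonnegative; pin the origin). -/
theorem TwoLegGridMomentsAt.budget_nonneg [NeZero M] {Zt Zs β U μ : ℝ} {K : TrigPolyC4v} {n : ℕ} (h : TwoLegGridMomentsAt L M Zt Zs β U μ K n)
    (hβ : 0 < β) (hU : U ≠ 0) : 0 ≤ Zt ∧ 0 ≤ Zs := by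
  have hN : 0 < 2 * (2 * M) := by have := NeZero.ne M; omega
  have hNr : (0 : ℝ) < ((2 * (2 * M) : ℕ) : ℝ) := by exact_mod_cast hN
  have hw : 0 < β / (2 * ((2 * (2 * M) : ℕ) : ℝ)) := by positivity
  have hU2 : 0 < U ^ 2 := by positivity
  have hpos : ∀ Z : ℝ, 0 ≤ Z * U ^ 2 * (β / (2 * ((2 * (2 * M) : ℕ) : ℝ))) → 0 ≤ Z := fun Z hZ => by
    by_contra hlt
    linarith [mul_neg_of_neg_of_pos (mul_neg_of_neg_of_pos (lt_of_not_ge hlt) hU2) hw]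
  let p₀ : GridPoint L (2 * (2 * M)) := (⟨0, hN⟩, 0)
  refine ⟨hpos Zt ?_, hpos Zs ?_⟩
  · exact le_trans (sum_nonneg fun p₁ _ => mul_nonneg (mul_nonneg (div_nonneg hβ.le hNr.le) (Nat.cast_nonneg _)) (norm_nonneg _)) (h.1 0 p₀)
  · exact le_trans (sum_nonneg fun p₁ _ => mul_nonneg (by split_ifs <;> positivity) (norm_nonneg _)) (h.2 0 p₀)

variable (L M) [NeZero M]

/-- **`TwoLegGridFlowMomentsAt L M Zt Zs β U μ n`** — THE CLASS-#7 EXPORT IN GRID CURRENCY: the grid atom at the flow frame `K_n := klFlowFrameU L M β U μ n`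
(the `m = 2` line of the one-shot tower at scale `n`, read on the `4M` grid where the vertex is ultralocal). -/
def TwoLegGridFlowMomentsAt (Zt Zs : ℝ) (β U μ : ℝ) (n : ℕ) : Prop :=
  TwoLegGridMomentsAt L M Zt Zs β U μ (klFlowFrameU L M β U μ n) n

variable {L M}

/-- The export IS the atom at the flow frame. -/
theorem twoLegGridFlowMomentsAt_iff (Zt Zs β U μ : ℝ) (n : ℕ) :
    TwoLegGridFlowMomentsAt L M Zt Zs β U μ n ↔ TwoLegGridMomentsAt L M Zt Zs β U μ (klFlowFrameU L M β U μ n) n := Iff.rfl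

/-- Budget monotonicity of the export (`0 ≤ β`). -/
theorem TwoLegGridFlowMomentsAt.mono {Zt Zs Zt' Zs' β U μ : ℝ} {n : ℕ} (h : TwoLegGridFlowMomentsAt L M Zt Zs β U μ n) (hβ : 0 ≤ β)
    (ht : Zt ≤ Zt') (hs : Zs ≤ Zs') : TwoLegGridFlowMomentsAt L M Zt' Zs' β U μ n := TwoLegGridMomentsAt.mono h hβ ht hs

/-- The export's budgets are nonnegative (`U ≠ 0`, `0 < β`). -/
theorem TwoLegGridFlowMomentsAt.budget_nonneg {Zt Zs β U μ : ℝ} {n : ℕ} (h : TwoLegGridFlowMomentsAt L M Zt Zs β U μ n) (hβ : 0 < β)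
    (hU : U ≠ 0) : 0 ≤ Zt ∧ 0 ≤ Zs := TwoLegGridMomentsAt.budget_nonneg h hβ hU

end Model

end Summit.HubbardSuperconductivity.HubbardSuperconductivity.Theorems.KLRegimeSplit

namespace Summit.HubbardSuperconductivity.HubbardSuperconductivity.Theorems.EngineV8

set_option linter.dupNamespace false -- summit = problem name (single-conjunct summit), D-0017

open Real Finset Literature.MathematicalPhysics.QuantumLattice Literature.Probability.LatticeModels GrassmannAlgebra
open Literature.MathematicalPhysics.QuantumLattice.FermiRG Literature.MathematicalPhysics.QuantumLattice.BandSectorCounting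
open Literature.Probability.LatticeModels.BattleFederbush
open Summit.HubbardSuperconductivity.HubbardSuperconductivity.Theorems.KLProgrammeLegKernels
open Summit.HubbardSuperconductivity.HubbardSuperconductivity.Theorems.DispersionFlow
open Summit.HubbardSuperconductivity.HubbardSuperconductivity.Theorems.PerturbedFermiCurve
open Summit.HubbardSuperconductivity.HubbardSuperconductivity.Theorems.KLRegimeSplit
open Summit.HubbardSuperconductivity.HubbardSuperconductivity.Theorems.TwoPointAssembly
open Summit.HubbardSuperconductivity.HubbardSuperconductivity.Theorems.TwoLegFourier

/-! ## §2 Consumers: the slope sizes, and stub (e) modulo the grid export -/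

/-- The conversion built into the atom: `(2N/β)·(Z·U²·β/(2N)) = Z·U²` (`0 < β`, `N = 4M ≠ 0`). -/
theorem gridMoment_conversion {M : ℕ} [NeZero M] {β : ℝ} (hβ : 0 < β) (Z U : ℝ) :
    2 * ((2 * (2 * M) : ℕ) : ℝ) / β * (Z * U ^ 2 * (β / (2 * ((2 * (2 * M) : ℕ) : ℝ)))) = Z * U ^ 2 := by
  have hN : (0 : ℝ) < ((2 * (2 * M) : ℕ) : ℝ) := by have := NeZero.ne M; positivity
  field_simp

/-- **THE TWO SLOPE SIZES FROM THE GRID ATOM, every frame, every scale** (`0 < β`): `TwoLegGridMomentsAt L M Zt Zs β U μ K n` gives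
`|klFieldStrength … K n k − 1| ≤ Zt·U²` at every torus momentum and `‖fderiv ℝ (evalM (symInterp L (klLocSelfEnergyRe … K n − K∘p))) q‖ ≤ Zs·U²` at every `q`
(this lane's grid bridges `abs_klFieldStrength_sub_one_le_of_grid_time_moment_sub_counter_scale` / `twoLeg_sep_fderiv_of_grid_scale`, p536884). -/
theorem twoLeg_slopeSizes_of_twoLegGridMomentsAt {L M : ℕ} [NeZero L] [NeZero M] {β : ℝ} (hβ : 0 < β) {U μ : ℝ} {K : TrigPolyC4v} {n : ℕ}
    {Zt Zs : ℝ} (h : TwoLegGridMomentsAt L M Zt Zs β U μ K n) :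
    (∀ k : TorusSite 2 L, |klFieldStrength L M β U μ K n k - 1| ≤ Zt * U ^ 2) ∧
    ∀ q : Momentum, ‖fderiv ℝ
      (evalM (symInterp L (fun p => klLocSelfEnergyRe L M β U μ K n p - K.eval (latticeMomentum L p)))) q‖ ≤ Zs * U ^ 2 := by
  refine ⟨fun k => ?_, fun q => ?_⟩
  · have h1 := abs_klFieldStrength_sub_one_le_of_grid_time_moment_sub_counter_scale hβ U μ K n k h.1
    rwa [gridMoment_conversion hβ] at h1
  · have h1 := twoLeg_sep_fderiv_of_grid_scale hβ.ne' U μ K n h.2 q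
    rwa [two_mul_card_gridPoint_div hβ, gridMoment_conversion hβ] at h1

/-- **STUB (e) OF 20437 MODULO THE GRID EXPORT, ALLOWANCE FORM — package `(G, Q)`, thresholds AND jet tables as binders** (the `_GQJ` convention):
package rows `hGS`, `hQS`, `hQCL`; doors `c₃ ≤ klEngC₃3 P R`, `U₀c ≤ klEngU₀4 P R c`, `U₀c ≤ klE3U₀all R`; the stub's literal binders at `(G, Q)` with
`hJ : TwoLegReadJetBound L M cJ cJ' …`; then **`hD : TwoLegGridFlowMomentsAt L M Zt Zs β U μ n`**, the allowance rows `hZa : Zt ≤ 2^10·e¹⁸κ₀⁴·klE3Acum R`,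
`hSa : Zs ≤ 2^11·e¹⁸κ₀⁴·klE3Acum R`, and C1 `hcut`, C2 `hsp` ⇒ `TwoLegStepV17F2 L M G P Q R β U μ n`. -/
theorem stub_twoLeg_step_of_twoLegGridMomentsAt_GQJ (G : GeoConsts) (Q : EngConsts) (cJ cJ' : ℕ → ℝ) {c₃ U₀c : ℝ} (P : SplitConsts)
    (R : RenConsts) (c : ℝ)
    (hGS : ∀ k, cJ k ≤ G.S k) (hQS : ∀ k, cJ' k ≤ Q.S' k) (hQCL : ∀ (β : ℝ) (n : ℕ), 0 ≤ Q.CL β n)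
    (hc₃ : c₃ ≤ klEngC₃3 P R) (hU₀ : U₀c ≤ klEngU₀4 P R c) (hU₀all : U₀c ≤ klE3U₀all R) (hP : P.WF) (hR : R.WF2) (hc : 0 < c) (hc3 : c ≤ c₃)
    (μ : ℝ) (hμ : μ ∈ klWindowC) (U : ℝ) (hU : 0 < U) (hUle : U ≤ U₀c) (β : ℝ) (hβ : klBetaMin ≤ β) (hβc : β ≤ Real.exp (c / U ^ 2))
    (L M : ℕ) [NeZero L] [NeZero M] (hL : klEngL₃ β U ≤ L) (hM : klEngM₃ β U L ≤ M)
    (n : ℕ) (hn1 : 1 ≤ n) (hn : n ≤ nScales β + 1) (hreg : IsKLRegime U c (-(n : ℤ)))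
    (hhist : HistP klPredsV17F2 L M G P Q R β U μ 0 n)
    (hfr : FrameOK R U (nScales β) μ (klFlowFrameU L M β U μ n))
    (hE : EngineBoundsAtV17F2 L M G P Q β U μ n)
    (hJ : TwoLegReadJetBound L M cJ cJ' β U μ (klFlowFrameU L M β U μ n) n)
    {Zt Zs : ℝ} (hD : TwoLegGridFlowMomentsAt L M Zt Zs β U μ n)
    (hZa : Zt ≤ (2 : ℝ) ^ 10 * Real.exp 1 ^ 18 * Real.sqrt (2 * (7 + 1606732)) ^ 4 * klE3Acum R)
    (hSa : Zs ≤ (2 : ℝ) ^ 11 * Real.exp 1 ^ 18 * Real.sqrt (2 * (7 + 1606732)) ^ 4 * klE3Acum R)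
    (hcut : ∀ (Mq : ℕ → ℕ) (L₁ M₁ M₂ : ℕ) [NeZero L₁] [NeZero M₁] [NeZero M₂], L ≤ L₁ → Q.M0 β L₁ ≤ M₁ → Mq L₁ ≤ M₁ → M₁ ≤ M₂ →
      (∀ j < n, histV17F2 L₁ M₁ G P Q R β U μ j ∧ TwoLegSlopes L₁ M₁ R β U μ (klFlowFrameU L₁ M₁ β U μ j) j) →
      (∀ j < n, histV17F2 L₁ M₂ G P Q R β U μ j ∧ TwoLegSlopes L₁ M₂ R β U μ (klFlowFrameU L₁ M₂ β U μ j) j) →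
        ∀ θ : ℝ, |klLocalPart L₁ M₁ β U μ (klFlowFrameU L₁ M₁ β U μ n) n θ -
          klLocalPart L₁ M₂ β U μ (klFlowFrameU L₁ M₂ β U μ n) n θ| ≤ Q.CL β n / 4 / L₁)
    (hsp : ∀ (Mq : ℕ → ℕ) (L₁ L₂ M₂ : ℕ) [NeZero L₁] [NeZero L₂] [NeZero M₂], L ≤ L₁ → L₁ ∣ L₂ → Q.M0 β L₁ ≤ M₂ → Mq L₁ ≤ M₂ →
      Q.M0 β L₂ ≤ M₂ → Mq L₂ ≤ M₂ →
      (∀ j < n, histV17F2 L₁ M₂ G P Q R β U μ j ∧ TwoLegSlopes L₁ M₂ R β U μ (klFlowFrameU L₁ M₂ β U μ j) j) →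
      (∀ j < n, histV17F2 L₂ M₂ G P Q R β U μ j ∧ TwoLegSlopes L₂ M₂ R β U μ (klFlowFrameU L₂ M₂ β U μ j) j) →
        ∀ θ : ℝ, |klLocalPart L₁ M₂ β U μ (klFlowFrameU L₁ M₂ β U μ n) n θ -
          klLocalPart L₂ M₂ β U μ (klFlowFrameU L₂ M₂ β U μ n) n θ| ≤ Q.CL β n / 4 / L₁) :
    TwoLegStepV17F2 L M G P Q R β U μ n :=
  have hβ0 : 0 < β := lt_of_lt_of_le (by norm_num [klBetaMin]) hβ
  stub_twoLeg_step_of_gridMoments_GQJ G Q cJ cJ' P R c hGS hQS hQCL hc₃ hU₀ hU₀all hP hR hc hc3 μ hμ U hU hUle β hβ hβc L M hL hM n hn1 hn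
    hreg hhist hfr hE hJ (Z := Zt) (S := Zs) hD.1 hD.2 (le_of_eq (gridMoment_conversion hβ0 Zt U)) (le_of_eq (gridMoment_conversion hβ0 Zs U))
    hZa hSa hcut hsp

/-- **STUB (e) OF 20437 MODULO THE GRID EXPORT, GENERIC-THRESHOLD FORM** — as `…_GQJ` but the all-scales door `U₀c ≤ klE3U₀all R` and the two allowance
rows are replaced by the single coupling door **`hU₀m : U₀c ≤ klTwoLegMomU R Zt Zs`** (for DEFERRED budgets; p548102's door — the grid sizes `Zt·U²`,
`Zs·U²` are half the dual ones, so the same door pays): `hD : TwoLegGridFlowMomentsAt L M Zt Zs β U μ n` + C1/C2 ⇒ `TwoLegStepV17F2 L M G P Q R β U μ n`. -/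
theorem stub_twoLeg_step_of_twoLegGridMomentsAt_thr_GQJ (G : GeoConsts) (Q : EngConsts) (cJ cJ' : ℕ → ℝ) {c₃ U₀c : ℝ} (P : SplitConsts)
    (R : RenConsts) (c : ℝ) {Zt Zs : ℝ}
    (hGS : ∀ k, cJ k ≤ G.S k) (hQS : ∀ k, cJ' k ≤ Q.S' k) (hQCL : ∀ (β : ℝ) (n : ℕ), 0 ≤ Q.CL β n)
    (hc₃ : c₃ ≤ klEngC₃3 P R) (hU₀ : U₀c ≤ klEngU₀4 P R c) (hU₀m : U₀c ≤ klTwoLegMomU R Zt Zs) (hP : P.WF) (hR : R.WF2) (hc : 0 < c)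
    (hc3 : c ≤ c₃)
    (μ : ℝ) (hμ : μ ∈ klWindowC) (U : ℝ) (hU : 0 < U) (hUle : U ≤ U₀c) (β : ℝ) (hβ : klBetaMin ≤ β) (hβc : β ≤ Real.exp (c / U ^ 2))
    (L M : ℕ) [NeZero L] [NeZero M] (hL : klEngL₃ β U ≤ L) (hM : klEngM₃ β U L ≤ M)
    (n : ℕ) (hn1 : 1 ≤ n) (hn : n ≤ nScales β + 1) (hreg : IsKLRegime U c (-(n : ℤ)))
    (hhist : HistP klPredsV17F2 L M G P Q R β U μ 0 n)
    (hfr : FrameOK R U (nScales β) μ (klFlowFrameU L M β U μ n))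
    (hE : EngineBoundsAtV17F2 L M G P Q β U μ n)
    (hJ : TwoLegReadJetBound L M cJ cJ' β U μ (klFlowFrameU L M β U μ n) n)
    (hD : TwoLegGridFlowMomentsAt L M Zt Zs β U μ n)
    (hcut : ∀ (Mq : ℕ → ℕ) (L₁ M₁ M₂ : ℕ) [NeZero L₁] [NeZero M₁] [NeZero M₂], L ≤ L₁ → Q.M0 β L₁ ≤ M₁ → Mq L₁ ≤ M₁ → M₁ ≤ M₂ →
      (∀ j < n, histV17F2 L₁ M₁ G P Q R β U μ j ∧ TwoLegSlopes L₁ M₁ R β U μ (klFlowFrameU L₁ M₁ β U μ j) j) →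
      (∀ j < n, histV17F2 L₁ M₂ G P Q R β U μ j ∧ TwoLegSlopes L₁ M₂ R β U μ (klFlowFrameU L₁ M₂ β U μ j) j) →
        ∀ θ : ℝ, |klLocalPart L₁ M₁ β U μ (klFlowFrameU L₁ M₁ β U μ n) n θ -
          klLocalPart L₁ M₂ β U μ (klFlowFrameU L₁ M₂ β U μ n) n θ| ≤ Q.CL β n / 4 / L₁)
    (hsp : ∀ (Mq : ℕ → ℕ) (L₁ L₂ M₂ : ℕ) [NeZero L₁] [NeZero L₂] [NeZero M₂], L ≤ L₁ → L₁ ∣ L₂ → Q.M0 β L₁ ≤ M₂ → Mq L₁ ≤ M₂ →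
      Q.M0 β L₂ ≤ M₂ → Mq L₂ ≤ M₂ →
      (∀ j < n, histV17F2 L₁ M₂ G P Q R β U μ j ∧ TwoLegSlopes L₁ M₂ R β U μ (klFlowFrameU L₁ M₂ β U μ j) j) →
      (∀ j < n, histV17F2 L₂ M₂ G P Q R β U μ j ∧ TwoLegSlopes L₂ M₂ R β U μ (klFlowFrameU L₂ M₂ β U μ j) j) →
        ∀ θ : ℝ, |klLocalPart L₁ M₂ β U μ (klFlowFrameU L₁ M₂ β U μ n) n θ -
          klLocalPart L₂ M₂ β U μ (klFlowFrameU L₂ M₂ β U μ n) n θ| ≤ Q.CL β n / 4 / L₁) :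
    TwoLegStepV17F2 L M G P Q R β U μ n := by
  have _ := hP; have _ := hM; have _ := hn1; have _ := hreg; have _ := hhist; have _ := hE
  have hβ0 : 0 < β := lt_of_lt_of_le (by norm_num [klBetaMin]) hβ
  obtain ⟨hzt, hms⟩ := twoLeg_slopeSizes_of_twoLegGridMomentsAt hβ0 ((twoLegGridFlowMomentsAt_iff Zt Zs β U μ n).1 hD)
  obtain ⟨hZt0, hZs0⟩ := hD.budget_nonneg hβ0 hU.ne'
  obtain ⟨hfz, hfs⟩ := twoLegMoment_fits_of_le_klTwoLegMomU hR.2.2 hU (hUle.trans hU₀m)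
  have hU2 : 0 ≤ U ^ 2 := sq_nonneg U
  have hz : ∀ k ∈ klShell L μ (klFlowFrameU L M β U μ n) n,
      |klFieldStrength L M β U μ (klFlowFrameU L M β U μ n) n k - 1| ≤ R.cz * |U| := fun k _ =>
    (hzt k).trans (by nlinarith [mul_nonneg hZt0 hU2])
  have hfs' : Zs * U ^ 2 + 4 / 3 * R.Gfr 1 * U ^ 2 ≤ R.cz * |U| * (cDtmin (-1.2) (-0.05) / 2) := by nlinarith [mul_nonneg hZs0 hU2]
  exact twoLegStepV17F2_of_jets_sepTubeGradient_nestedLegs_pkg G Q P hR hc (hc3.trans hc₃) hμ hU (hUle.trans hU₀) hβ hβc hL hn hfr (hQCL β n)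
    hGS hQS hJ.1 hJ.2 hz (fun q _ => hms q) hfs' hcut hsp

/-! ### §2b The v2-day one-liners: geometry `klEngGeo8`, any raise `Q` of `klEngQ7 P R`, doors `klEngU₀10` / `klEngL₄` -/

section Raise

/-- The geometry row at `klEngGeo8` for a table dominated by `klEngGeo7.S`. -/
private theorem hGS8g (cJ : ℕ → ℝ) (hC : ∀ k, cJ k ≤ klEngGeo7.S k) : ∀ k, cJ k ≤ klEngGeo8.S k :=
  fun k => by rw [klEngGeo8_S]; exact hC k

/-- The `S'` row of a raise of `klEngQ7 P R`. -/
private theorem hQS_raise_g (P : SplitConsts) (R : RenConsts) (Q : EngConsts) (hQ : (klEngQ7 P R).IsRaiseOf Q) :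
    ∀ k, klC4aJetC' P R k ≤ Q.S' k := fun k => by rw [hQ.S'_eq]; exact klC4aJetC'_le_klEngQ7_S' P R k

/-- The `CL` row of a raise of `klEngQ7 P R`. -/
private theorem hQCL_raise_g (P : SplitConsts) (R : RenConsts) (Q : EngConsts) (hQ : (klEngQ7 P R).IsRaiseOf Q) :
    ∀ (β : ℝ) (n : ℕ), 0 ≤ Q.CL β n := fun β n => by rw [hQ.CL_eq]; exact klEngQ7_CL_nonneg P R β n

variable (P : SplitConsts) (R : RenConsts) (c : ℝ) (Q : EngConsts) (hQ : (klEngQ7 P R).IsRaiseOf Q) (cJ : ℕ → ℝ) (hC : ∀ k, cJ k ≤ klEngGeo7.S k)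
include hQ hC

/-- **STUB (e) v2, (e)-HGRID SHAPE, RAISE-GENERIC, ALLOWANCE FORM**: for any raise `Q` of `klEngQ7 P R`, geometry `klEngGeo8`, doors `klEngC₃6 / klEngU₀10 / klEngL₄ /
klEngM₃`, table `cJ ≤ klEngGeo7.S`: stub (e)'s binders at `(klEngGeo8, Q)` + `hJ` (stub (C)) + `hgrid : TwoLegGridFlowMomentsAt L M Zt Zs β U μ n` + the two
allowance rows + C1/C2 literal ⇒ `TwoLegStepV17F2 L M klEngGeo8 P Q R β U μ n`. -/
theorem stub_twoLeg_step_of_twoLegGridMomentsAt_raise (hP : P.WF) (hR : R.WF2) (hc : 0 < c) (hc3 : c ≤ klEngC₃6 P R)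
    (μ : ℝ) (hμ : μ ∈ klWindowC) (U : ℝ) (hU : 0 < U) (hUle : U ≤ klEngU₀10 P R c) (β : ℝ) (hβ : klBetaMin ≤ β)
    (hβc : β ≤ Real.exp (c / U ^ 2)) (L M : ℕ) [NeZero L] [NeZero M] (hL : klEngL₄ P R β U ≤ L) (hM : klEngM₃ β U L ≤ M)
    (n : ℕ) (hn1 : 1 ≤ n) (hn : n ≤ nScales β + 1) (hreg : IsKLRegime U c (-(n : ℤ)))
    (hhist : HistP klPredsV17F2 L M klEngGeo8 P Q R β U μ 0 n)
    (hfr : FrameOK R U (nScales β) μ (klFlowFrameU L M β U μ n))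
    (hE : EngineBoundsAtV17F2 L M klEngGeo8 P Q β U μ n)
    (hJ : TwoLegReadJetBound L M cJ (klC4aJetC' P R) β U μ (klFlowFrameU L M β U μ n) n)
    {Zt Zs : ℝ} (hgrid : TwoLegGridFlowMomentsAt L M Zt Zs β U μ n)
    (hZa : Zt ≤ (2 : ℝ) ^ 10 * Real.exp 1 ^ 18 * Real.sqrt (2 * (7 + 1606732)) ^ 4 * klE3Acum R)
    (hSa : Zs ≤ (2 : ℝ) ^ 11 * Real.exp 1 ^ 18 * Real.sqrt (2 * (7 + 1606732)) ^ 4 * klE3Acum R)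
    (hcut : ∀ (Mq : ℕ → ℕ) (L₁ M₁ M₂ : ℕ) [NeZero L₁] [NeZero M₁] [NeZero M₂], L ≤ L₁ → Q.M0 β L₁ ≤ M₁ → Mq L₁ ≤ M₁ → M₁ ≤ M₂ →
      (∀ j < n, histV17F2 L₁ M₁ klEngGeo8 P Q R β U μ j ∧ TwoLegSlopes L₁ M₁ R β U μ (klFlowFrameU L₁ M₁ β U μ j) j) →
      (∀ j < n, histV17F2 L₁ M₂ klEngGeo8 P Q R β U μ j ∧ TwoLegSlopes L₁ M₂ R β U μ (klFlowFrameU L₁ M₂ β U μ j) j) →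
        ∀ θ : ℝ, |klLocalPart L₁ M₁ β U μ (klFlowFrameU L₁ M₁ β U μ n) n θ -
          klLocalPart L₁ M₂ β U μ (klFlowFrameU L₁ M₂ β U μ n) n θ| ≤ Q.CL β n / 4 / L₁)
    (hsp : ∀ (Mq : ℕ → ℕ) (L₁ L₂ M₂ : ℕ) [NeZero L₁] [NeZero L₂] [NeZero M₂], L ≤ L₁ → L₁ ∣ L₂ → Q.M0 β L₁ ≤ M₂ → Mq L₁ ≤ M₂ →
      Q.M0 β L₂ ≤ M₂ → Mq L₂ ≤ M₂ →
      (∀ j < n, histV17F2 L₁ M₂ klEngGeo8 P Q R β U μ j ∧ TwoLegSlopes L₁ M₂ R β U μ (klFlowFrameU L₁ M₂ β U μ j) j) →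
      (∀ j < n, histV17F2 L₂ M₂ klEngGeo8 P Q R β U μ j ∧ TwoLegSlopes L₂ M₂ R β U μ (klFlowFrameU L₂ M₂ β U μ j) j) →
        ∀ θ : ℝ, |klLocalPart L₁ M₂ β U μ (klFlowFrameU L₁ M₂ β U μ n) n θ -
          klLocalPart L₂ M₂ β U μ (klFlowFrameU L₂ M₂ β U μ n) n θ| ≤ Q.CL β n / 4 / L₁) :
    TwoLegStepV17F2 L M klEngGeo8 P Q R β U μ n :=
  stub_twoLeg_step_of_twoLegGridMomentsAt_GQJ klEngGeo8 Q cJ (klC4aJetC' P R) P R c (hGS8g cJ hC) (hQS_raise_g P R Q hQ)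
    (hQCL_raise_g P R Q hQ) (klEngC₃6_le_klEngC₃3 P R) (klEngU₀10_le_klEngU₀4 P R c) (klEngU₀10_le_klE3U₀all P R c) hP hR hc hc3 μ hμ U hU hUle
    β hβ hβc L M (klEngL₃_le_of_klEngL₄_le hL) hM n hn1 hn hreg hhist hfr hE hJ hgrid hZa hSa hcut hsp

/-- **STUB (e) v2, (e)-HGRID SHAPE, RAISE-GENERIC, GENERIC-THRESHOLD FORM** (the deferred-budget branch): as above with the allowance rows replaced by the
door `U ≤ klTwoLegMomU R Zt Zs`. -/
theorem stub_twoLeg_step_of_twoLegGridMomentsAt_thr_raise (hP : P.WF) (hR : R.WF2) (hc : 0 < c) (hc3 : c ≤ klEngC₃6 P R)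
    (μ : ℝ) (hμ : μ ∈ klWindowC) (U : ℝ) (hU : 0 < U) (hUle : U ≤ klEngU₀10 P R c) {Zt Zs : ℝ} (hUm : U ≤ klTwoLegMomU R Zt Zs) (β : ℝ)
    (hβ : klBetaMin ≤ β) (hβc : β ≤ Real.exp (c / U ^ 2)) (L M : ℕ) [NeZero L] [NeZero M] (hL : klEngL₄ P R β U ≤ L) (hM : klEngM₃ β U L ≤ M)
    (n : ℕ) (hn1 : 1 ≤ n) (hn : n ≤ nScales β + 1) (hreg : IsKLRegime U c (-(n : ℤ)))
    (hhist : HistP klPredsV17F2 L M klEngGeo8 P Q R β U μ 0 n)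
    (hfr : FrameOK R U (nScales β) μ (klFlowFrameU L M β U μ n))
    (hE : EngineBoundsAtV17F2 L M klEngGeo8 P Q β U μ n)
    (hJ : TwoLegReadJetBound L M cJ (klC4aJetC' P R) β U μ (klFlowFrameU L M β U μ n) n)
    (hgrid : TwoLegGridFlowMomentsAt L M Zt Zs β U μ n)
    (hcut : ∀ (Mq : ℕ → ℕ) (L₁ M₁ M₂ : ℕ) [NeZero L₁] [NeZero M₁] [NeZero M₂], L ≤ L₁ → Q.M0 β L₁ ≤ M₁ → Mq L₁ ≤ M₁ → M₁ ≤ M₂ →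
      (∀ j < n, histV17F2 L₁ M₁ klEngGeo8 P Q R β U μ j ∧ TwoLegSlopes L₁ M₁ R β U μ (klFlowFrameU L₁ M₁ β U μ j) j) →
      (∀ j < n, histV17F2 L₁ M₂ klEngGeo8 P Q R β U μ j ∧ TwoLegSlopes L₁ M₂ R β U μ (klFlowFrameU L₁ M₂ β U μ j) j) →
        ∀ θ : ℝ, |klLocalPart L₁ M₁ β U μ (klFlowFrameU L₁ M₁ β U μ n) n θ -
          klLocalPart L₁ M₂ β U μ (klFlowFrameU L₁ M₂ β U μ n) n θ| ≤ Q.CL β n / 4 / L₁)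
    (hsp : ∀ (Mq : ℕ → ℕ) (L₁ L₂ M₂ : ℕ) [NeZero L₁] [NeZero L₂] [NeZero M₂], L ≤ L₁ → L₁ ∣ L₂ → Q.M0 β L₁ ≤ M₂ → Mq L₁ ≤ M₂ →
      Q.M0 β L₂ ≤ M₂ → Mq L₂ ≤ M₂ →
      (∀ j < n, histV17F2 L₁ M₂ klEngGeo8 P Q R β U μ j ∧ TwoLegSlopes L₁ M₂ R β U μ (klFlowFrameU L₁ M₂ β U μ j) j) →
      (∀ j < n, histV17F2 L₂ M₂ klEngGeo8 P Q R β U μ j ∧ TwoLegSlopes L₂ M₂ R β U μ (klFlowFrameU L₂ M₂ β U μ j) j) →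
        ∀ θ : ℝ, |klLocalPart L₁ M₂ β U μ (klFlowFrameU L₁ M₂ β U μ n) n θ -
          klLocalPart L₂ M₂ β U μ (klFlowFrameU L₂ M₂ β U μ n) n θ| ≤ Q.CL β n / 4 / L₁) :
    TwoLegStepV17F2 L M klEngGeo8 P Q R β U μ n :=
  stub_twoLeg_step_of_twoLegGridMomentsAt_thr_GQJ klEngGeo8 Q cJ (klC4aJetC' P R) P R c (U₀c := min (klEngU₀10 P R c) (klTwoLegMomU R Zt Zs))
    (hGS8g cJ hC) (hQS_raise_g P R Q hQ) (hQCL_raise_g P R Q hQ) (klEngC₃6_le_klEngC₃3 P R)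
    ((min_le_left _ _).trans (klEngU₀10_le_klEngU₀4 P R c)) (min_le_right _ _) hP hR hc hc3 μ hμ U hU (le_min hUle hUm) β hβ hβc L M
    (klEngL₃_le_of_klEngL₄_le hL) hM n hn1 hn hreg hhist hfr hE hJ hgrid hcut hsp

end Raise

/-! ## §3 The n = 0 base of the grid export, PROVED -/

section Base

variable {L M : ℕ} [NeZero L] [NeZero M] {R : RenConsts} {μ U β a₁ : ℝ}

/-- **THE GRID ATOM AT `(K, n) = (0, 0)` FROM ONE COVARIANCE NUMBER** (`R.WF`, `μ ∈ klWindowC`, `0 < U`, `|U| ≤ 1`, the volume thresholds, `a₁ > 0` with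
`A₁(R,U) ≤ a₁` — p3's definite `gridLabelWt`-weighted decay constant of the bare scale-`0` grid covariance — and `16e⁹κ₀²·a₁·|U| ≤ 1/2`):
`TwoLegGridMomentsAt L M (2^10·e¹⁸κ₀⁴·a₁) (2^11·e¹⁸κ₀⁴·a₁) β U μ 0 0` — p1b/p3's `twoLeg_time_sum_frameZero_le` and `twoLeg_offDiag_moment_pow_sum_frameZero_le`
(k = 1) read in the atom's normalisation (`𝒩_{0,4M} = 0`, `klScale klE0 0 = klE0`). -/
theorem twoLegGridMomentsAt_frameZero_of_bareAlpha (hRW : R.WF) (hμ : μ ∈ klWindowC) (hU : 0 < U) (hU1 : |U| ≤ 1) (hβ : klBetaMin ≤ β)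
    (hL : klEngL₃ β U ≤ L) (hM : klEngM₃ β U L ≤ M) (ha : 0 < a₁)
    (hA : klScaleZeroA0 + uvTimeMomentConst klE0 7 32 +
          2 * (uvSpaceMomentConst klE0 1 (uvPieceSq klE0 (uvBaseQ klCutoffX5 klE0 4) (uvBaseQ' klCutoffX5 klE0 4)) +
            (1 / 4 * Real.sqrt (216 * (1 / klE0 + 1 / 2)) *
                ∑ e : Fin 2 × Fin 2, (uvLinV klE0 (1 + (e.1 : ℕ) + (e.2 : ℕ)) *
                    (klCutoffX5 * ((1 + ((e.1 : ℕ) + (e.2 : ℕ)) + 2).factorial : ℝ) * (4 / klE0) ^ (1 + ((e.1 : ℕ) + (e.2 : ℕ)) + 1)) +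
                  uvLinD klE0 (1 + (e.1 : ℕ) + (e.2 : ℕ)) *
                    (klCutoffX5 * ((1 + ((e.1 : ℕ) + (e.2 : ℕ)) + 3).factorial : ℝ) * (4 / klE0) ^ (1 + ((e.1 : ℕ) + (e.2 : ℕ)) + 2)))) *
              (4608 * (1 + R.Gfr 0 + R.Gfr 1 + R.Gfr 2 + R.Gfr 3) ^ 4 * ((((0 : ℕ) : ℝ) + 1) * U ^ 2 + 2 * |U|))) ≤ a₁)
    (hsmall : 16 * Real.exp 1 ^ 9 * Real.sqrt (2 * (7 + 1606732)) ^ 2 * a₁ * |U| ≤ 1 / 2) :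
    TwoLegGridMomentsAt L M ((2 : ℝ) ^ 10 * Real.exp 1 ^ 18 * Real.sqrt (2 * (7 + 1606732)) ^ 4 * a₁)
      ((2 : ℝ) ^ 11 * Real.exp 1 ^ 18 * Real.sqrt (2 * (7 + 1606732)) ^ 4 * a₁) β U μ 0 0 := by
  haveI : NeZero (2 * (2 * M)) := ⟨by have := NeZero.ne M; omega⟩
  have hrow := bareAlphaRow_le (L := L) (M := M) hRW hμ hU1 hβ hL hM hA
  have hcol := bareAlphaCol_le (L := L) (M := M) hRW hμ hU1 hβ hL hM hA
  have hrowd : ∀ X, ∑ Y, ‖((hubbardGridSub L M β (2 * (2 * M))).transpose * hubbardCovAboveCT L M β μ 0 0 klE0 *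
      hubbardGridSub L M β (2 * (2 * M))) X Y‖ *
      diamWeight (fun s => (1 + 1 * s) ^ 1) (gridLabelDist L (2 * (2 * M)) β) {gridLegPos X, gridLegPos Y} ≤ a₁ * ((2 * (2 * M) : ℕ) : ℝ) / β :=
    fun X => by simpa only [← gridLabelWt_eq_polyWt_one] using hrow X
  have hcold : ∀ Y, ∑ X, ‖((hubbardGridSub L M β (2 * (2 * M))).transpose * hubbardCovAboveCT L M β μ 0 0 klE0 *
      hubbardGridSub L M β (2 * (2 * M))) X Y‖ *
      diamWeight (fun s => (1 + 1 * s) ^ 1) (gridLabelDist L (2 * (2 * M)) β) {gridLegPos X, gridLegPos Y} ≤ a₁ * ((2 * (2 * M) : ℕ) : ℝ) / β :=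
    fun Y => by simpa only [← gridLabelWt_eq_polyWt_one] using hcol Y
  have h0 : hubbardGridCounterQuadratic L (2 * (2 * M)) β (0 : TrigPolyC4v) = 0 := hubbardGridCounterQuadratic_frameZero' β
  have hsc : klScale klE0 0 = klE0 := by simp [klScale]
  refine ⟨fun σ p₀ => ?_, fun σ p₀ => ?_⟩
  · have h := twoLeg_time_sum_frameZero_le (L := L) (M := M) hRW 0 hμ hU hβ hL hM ha hrow hcol hsmall σ p₀
    rw [hsc, h0, add_zero, sub_zero]
    refine h.trans (le_of_eq ?_)
    ring
  · have h := twoLeg_offDiag_moment_pow_sum_frameZero_le (L := L) (M := M) hRW 0 hμ hU hβ hL hM 1 ha hrowd hcold hsmall σ p₀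
    rw [hsc, h0, add_zero, sub_zero]
    refine h.trans (le_of_eq ?_)
    ring

/-- **THE n = 0 BASE OF THE GRID EXPORT UNDER THE REGISTERED DOOR** (`R.WF2`, `μ ∈ klWindowC`, `0 < U ≤ klEngU₀9 P R c`, `klBetaMin ≤ β`, the volume
thresholds): `TwoLegGridFlowMomentsAt L M (2^10·e¹⁸κ₀⁴·klE3A1 R) (2^11·e¹⁸κ₀⁴·klE3A1 R) β U μ 0` — `a₁ := klE3A1 R` (`bareAlphaOne_le_klE3A1`), the smallness
from the (E3-THR) door `bareFrame_numerals_of_le_klEngU₀9`, `K₀ = 0` (`klFlowFrameU_zero`). -/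
theorem twoLegGridFlowMomentsAt_zero_klE3A1 (P : SplitConsts) (hR : R.WF2) {c : ℝ} (hμ : μ ∈ klWindowC) (hU : 0 < U)
    (hUle : U ≤ klEngU₀9 P R c) (hβ : klBetaMin ≤ β) (hL : klEngL₃ β U ≤ L) (hM : klEngM₃ β U L ≤ M) :
    TwoLegGridFlowMomentsAt L M ((2 : ℝ) ^ 10 * Real.exp 1 ^ 18 * Real.sqrt (2 * (7 + 1606732)) ^ 4 * klE3A1 R)
      ((2 : ℝ) ^ 11 * Real.exp 1 ^ 18 * Real.sqrt (2 * (7 + 1606732)) ^ 4 * klE3A1 R) β U μ 0 := by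
  have hU1 : U ≤ 1 := le_one_of_le_klEngU₀3 (hUle.trans (klEngU₀9_le_klEngU₀3 P R c))
  have hU1' : |U| ≤ 1 := by rw [abs_of_pos hU]; exact hU1
  obtain ⟨-, hs1, -, -⟩ := bareFrame_numerals_of_le_klEngU₀9 P hR.2.2 hU hUle
  rw [twoLegGridFlowMomentsAt_iff, klFlowFrameU_zero]
  exact twoLegGridMomentsAt_frameZero_of_bareAlpha hR.1 hμ hU hU1' hβ hL hM (klE3A1_pos R) (bareAlphaOne_le_klE3A1 R hU1') hs1

/-- **The n = 0 budgets sit inside the (e) allowance rows**: `2^10·e¹⁸κ₀⁴·klE3A1 R ≤ 2^10·e¹⁸κ₀⁴·klE3Acum R` and `2^11·… ≤ 2^11·…·klE3Acum R`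
(`klE3A1_le_klE3Acum`) — so at n = 0 the allowance form `stub_twoLeg_step_of_twoLegGridMomentsAt_GQJ` needs no door beyond the registered ones. -/
theorem twoLegGridMoments_zero_allowance (R : RenConsts) :
    (2 : ℝ) ^ 10 * Real.exp 1 ^ 18 * Real.sqrt (2 * (7 + 1606732)) ^ 4 * klE3A1 R ≤
        (2 : ℝ) ^ 10 * Real.exp 1 ^ 18 * Real.sqrt (2 * (7 + 1606732)) ^ 4 * klE3Acum R ∧
      (2 : ℝ) ^ 11 * Real.exp 1 ^ 18 * Real.sqrt (2 * (7 + 1606732)) ^ 4 * klE3A1 R ≤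
        (2 : ℝ) ^ 11 * Real.exp 1 ^ 18 * Real.sqrt (2 * (7 + 1606732)) ^ 4 * klE3Acum R :=
  ⟨mul_le_mul_of_nonneg_left (klE3A1_le_klE3Acum R) (by positivity), mul_le_mul_of_nonneg_left (klE3A1_le_klE3Acum R) (by positivity)⟩

end Base

end Summit.HubbardSuperconductivity.HubbardSuperconductivity.Theorems.EngineV8

end
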